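import Summits.ResolutionOfSingularities.ResolutionOfSingularities.Theorems.PurelyInseparableDim4InScopeWinCertHorner
import Summits.ResolutionOfSingularities.ResolutionOfSingularities.Theorems.PurelyInseparableDim4InScopeWinCertFastF
import HarnessLib
import HarnessLib.Audit.Tags

/-!
# Purely inseparable fourfolds — IN-SCOPE WIN CERTIFICATES, FAST CHECKER 3 (Horner child), F-KEYED citation
# [OURS · counted 0 · a certificate format for OUR frame v4, not about resolution]

Census cell «res-dim4-pi» (D-0157 DOOR 2), width seat `res-dim4-p-13` (generation 4); written at res-dim4-p-4 g4's call
(bus 10:34:16Z: «p-13 write HornerF», their `…FastT` withdrawn so that the tree keeps ONE fast translate).  The layer of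
`PurelyInseparableDim4InScopeWinCertHorner` (`stepDH` = child with the translation by Horner's rule on sorted term lists,
`stepDH_toState`; Hasse–Taylor test `equiHB` first) over res-dim4-p-13 g2's F-KEYED checker `…InScopeWinCertF`
(`ichildInF`/`ireplyOKF`/`irowOKF`/`iwinCertBLF`: a child is CITED BY ITS POLYNOMIAL, the books `r`, `exc` are not read —
sound by `FlatAbsorb.inScopeStateWins_congr`), exactly as p-14's `…InScopeWinCertFastF` layers the Hasse–Taylor test:

* `ichildInHF rest c` — the child's term list occurs among `rest` (syntactic list equality first, the coefficient
  comparison `StepKit.equivB` as fall-back); `ireplyTOKF`, `irowTOKF`, **`iwinCertTBLF q L T`**;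
* REDUCTION row by row to the landed F-keyed checker: `ireplyOKF_of_ireplyTOKF`, `irowOKF_of_irowTOKF`,
  `iwinCertBLF_of_iwinCertTBLF`; SOUNDNESS **`inScopeStateWins_of_iwinCertTBLF`** /
  `inScopeStateWins_head_of_iwinCertTBLF` — literally `…WinCertF`'s conclusion `∀ row ∈ T, InScopeStateWins q row.1.toState`
  from `(hL : ∀ s ∈ L, InScopeStateWins q s.toState)`; model `iwinCertTBLF_scopeLossCert` (`decide +kernel`).

Consumers: res-dim4-p-10 g4's unit-leaf certificates (heavy rows of weight 1,000–2,000; p-4 g4's datum l.5942).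
Riders as before: `K`-rational replies over the finite field `K` of the certificate only (NOT ∀K); a statement about OUR
frame-v4 game; nothing here proves resolution of singularities in dimension ≥ 4 / characteristic `p`; F4-C(2,2) neither
proved nor refuted.  [OURS · counted 0 · AI kernel work, weaker than expert review.]
bears_on: LADDER-RESOLUTION:D157-DOOR2 (res-dim4-pi · F4-C instrument · certificate format). Supports
stmt-ResolutionOfSingularities-16155 (helper).
-/

set_option linter.dupNamespace false

noncomputable section

namespace Summit.ResolutionOfSingularities.ResolutionOfSingularities.Theorems.PIDim4

namespace InScopeWinCert

open StepKit WinCertSound ScopeBlind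
open Literature.AlgebraicGeometry.Resolution
open Literature.AlgebraicGeometry.Resolution.CentreBlowup

variable {K : Type} [Field K] [DecidableEq K] [Fintype K]

/-! ## 1. The checker -/

/-- **F-keyed child look-up, Horner form**: the child's TERM LIST occurs among the states of `rest` — syntactic equality
of the (sorted, normalised) lists first, the coefficient comparison as fall-back; books ignored. [folklore] -/
def ichildInHF (rest : ICert K) (c : SData 4 K) : Bool :=
  rest.any fun r => decide (c.L = r.1.L) || StepKit.equivB c.L r.1.L

omit [Fintype K] in
/-- `ichildInHF` implies the landed F-keyed look-up. [folklore] -/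
theorem ichildInF_of_ichildInHF [Fintype K] {rest : ICert K} {c : SData 4 K} (h : ichildInHF rest c = true) :
    ichildInF rest c = true := by
  unfold ichildInHF at h
  unfold ichildInF
  obtain ⟨r, hr, hrc⟩ := List.any_eq_true.mp h
  refine List.any_eq_true.mpr ⟨r, hr, ?_⟩
  rcases (Bool.or_eq_true _ _).mp hrc with hL | hL
  · rw [decide_eq_true_eq] at hL
    rw [← evalT_eq_iff_equivB, hL]
  · exact hL

/-- B's reply `(j, b)` is harmless (Hasse–Taylor test, Horner child, F-keyed citation). [folklore] -/
def ireplyTOKF (q : ℕ) (rest : ICert K) (s : SData 4 K) (S : Finset (Fin 4)) (j : Fin 4) (b : Fin 4 → K) : Bool :=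
  !(equiHB q S j b s) || (StepKit.equivB (stepDH q S j b s).L [] || ichildInHF rest (stepDH q S j b s))

/-- The row check (Horner child, F-keyed). [folklore] -/
def irowTOKF (q : ℕ) (rest : ICert K) (row : IRow K) : Bool :=
  blindOK q row || !(permB q Finset.univ row.1.L) ||
    (permB q row.2.1 row.1.L &&
      decide (∀ j ∈ row.2.1, ∀ b : Fin 4 → K, b j = 0 → ireplyTOKF q rest row.1 row.2.1 j b = true))

/-- **Fast checker 3, F-keyed, with external leaves.** [folklore] -/
def iwinCertTBLF (q : ℕ) (L : List (SData 4 K)) : ICert K → Bool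
  | [] => true
  | row :: rest => irowTOKF q (rest ++ leafRows L) row && iwinCertTBLF q L rest

/-! ## 2. Reduction to the landed F-keyed checker, soundness -/

omit [Fintype K] in
/-- A reply harmless in the Horner F-keyed form is harmless in the landed F-keyed form. [folklore] -/
theorem ireplyOKF_of_ireplyTOKF [Fintype K] {q : ℕ} {rest : ICert K} {s : SData 4 K} {S : Finset (Fin 4)} {j : Fin 4}
    {b : Fin 4 → K} (h : ireplyTOKF q rest s S j b = true) : ireplyOKF q rest s S j b = true := by
  unfold ireplyTOKF at h
  unfold ireplyOKF
  cases hH : equiHB q S j b s with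
  | false => rw [equiB_eq_false_of_equiHB hH]; simp
  | true =>
    rw [hH] at h
    simp only [Bool.not_true, Bool.false_or, Bool.or_eq_true] at h
    rw [Bool.or_eq_true, Bool.or_eq_true]
    rcases h with hz | hc
    · refine Or.inl (Or.inr ?_)
      rw [← evalT_eq_zero_iff] at hz ⊢
      rwa [← SData.toState_F, stepDH_toState, SData.toState_F] at hz
    · refine Or.inr ?_
      have hF := ichildInF_of_ichildInHF hc
      unfold ichildInF at hF ⊢
      obtain ⟨r, hr, hrc⟩ := List.any_eq_true.mp hF
      refine List.any_eq_true.mpr ⟨r, hr, ?_⟩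
      rw [← evalT_eq_iff_equivB] at hrc ⊢
      rw [← SData.toState_F, ← stepDH_toState, SData.toState_F]
      exact hrc

/-- A fast-3-OK row is OK (F-keyed). [folklore] -/
theorem irowOKF_of_irowTOKF {q : ℕ} {rest : ICert K} {row : IRow K} (h : irowTOKF q rest row = true) :
    irowOKF q rest row = true := by
  unfold irowTOKF at h
  unfold irowOKF
  simp only [Bool.or_eq_true, Bool.and_eq_true, Bool.not_eq_true', decide_eq_true_eq] at h ⊢
  rcases h with (hb | ht) | ⟨hp, hr⟩
  · exact Or.inl (Or.inl hb)
  · exact Or.inl (Or.inr ht)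
  · exact Or.inr ⟨hp, fun j hj b hb => ireplyOKF_of_ireplyTOKF (hr j hj b hb)⟩

/-- **Reduction**: a certificate passing fast checker 3 (F-keyed) passes the landed F-keyed checker. [folklore] -/
theorem iwinCertBLF_of_iwinCertTBLF {q : ℕ} {L : List (SData 4 K)} :
    ∀ {T : ICert K}, iwinCertTBLF q L T = true → iwinCertBLF q L T = true
  | [], _ => rfl
  | row :: rest, h => by
    simp only [iwinCertTBLF, Bool.and_eq_true] at h
    simp only [iwinCertBLF, Bool.and_eq_true]
    exact ⟨irowOKF_of_irowTOKF h.1, iwinCertBLF_of_iwinCertTBLF h.2⟩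

/-- **SOUNDNESS OF FAST CHECKER 3, F-KEYED, WITH EXTERNAL LEAVES**: if every leaf state is in-scope escapable, so is every
row state of a certificate passing `iwinCertTBLF`. [folklore] -/
theorem inScopeStateWins_of_iwinCertTBLF {q : ℕ} {L : List (SData 4 K)} (hL : ∀ s ∈ L, InScopeStateWins q s.toState)
    {T : ICert K} (h : iwinCertTBLF q L T = true) : ∀ row ∈ T, InScopeStateWins q row.1.toState :=
  inScopeStateWins_of_iwinCertBLF hL (iwinCertBLF_of_iwinCertTBLF h)

/-- The ROOT of a checked certificate is in-scope escapable. [folklore] -/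
theorem inScopeStateWins_head_of_iwinCertTBLF {q : ℕ} {L : List (SData 4 K)}
    (hL : ∀ s ∈ L, InScopeStateWins q s.toState) {row : IRow K} {rest : ICert K}
    (h : iwinCertTBLF q L (row :: rest) = true) : InScopeStateWins q row.1.toState :=
  inScopeStateWins_of_iwinCertTBLF hL h row List.mem_cons_self

/-! ## 3. Model -/

/-- p-14's PR-12u model certificate `scopeLossCert` (over `𝔽₂`) passes fast checker 3, F-keyed, with no leaves.
[OURS · ‖ K] [folklore] -/
theorem iwinCertTBLF_scopeLossCert : iwinCertTBLF 2 ([] : List (SData 4 (ZMod 2))) scopeLossCert = true := by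
  decide +kernel

end InScopeWinCert

end Summit.ResolutionOfSingularities.ResolutionOfSingularities.Theorems.PIDim4

end
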